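import Summits.BirchSwinnertonDyer.BirchSwinnertonDyer.Theorems.ManinLocalTwoThreeUFamilyConductorAtTwo
import Summits.BirchSwinnertonDyer.BirchSwinnertonDyer.Theorems.ManinLocalTwoThreeNegOneTwistConductorFourMulHolds
import Summits.BirchSwinnertonDyer.Rank1Residual.ManinAdditive.CuspidalKummerUFamilyCurve
import HarnessLib

/-!
# S-an-64 `UFamilyConductorLaw` IS A THEOREM: on the totally-blind family `y² = (x + u)(x² + 4)`, `u` odd,
# `u ≡ 1 (mod 4) ⟹ 4 ∥ N(W)` and `u ≡ 3 (mod 4) ⟹ N(W) = 4 · N(W ⊗ χ₋₄)`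
# (route `ManinLocalTwoThree`, crux C2 `ManinOddAtFour` stmt-BirchSwinnertonDyer-22967; cell bsd-f2-manin, an g32 MEMO-an §75.11,
# CANDIDATES row S-an-64; p3 gen 12)

The assembly of an's census law S-an-64 (the conductor input of `uFamily_two_not_dvd_c_of_odd`, the ODD-`u` half of the
totally-blind residual E-an-50R `UFamilyManinOdd`) from three tree theorems:
* the local half `padicValNat_two_conductorNorm_of_uFamily` (sibling `…UFamilyConductorAtTwo`: Tate's algorithm over `ℤ₂`, type IV*,
  `f₂ = 2`, for `u ≡ 1 (mod 4)`), which gives the first clause and — applied to the twist, a member of the family with parameter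
  `−u ≡ 1 (mod 4)` (`uFamily_quadraticTwist_negOne`) — `4 ∥ N(W ⊗ χ₋₄)` in the second;
* p2's S-an-58 `conductorNorm_quadraticTwist_negOne_eq_four_mul` (`4 ∥ N(V) ⟹ N(V ⊗ χ₋₄) = 4·N(V)`) at `V = W ⊗ χ₋₄`;
* `N(W ⊗ χ₋₄ ⊗ χ₋₄) = N(W)` (`conductorNorm_quadraticTwist_negOne_negOne`: the double twist is `W ⊗ 1 ≅ W`).

`uFamilyConductorLaw_of` is the body (hypothesis = an's `IsUFamilyCurve W u` unfolded); **`uFamilyConductorLaw_holds :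
UFamilyConductorLaw`** discharges the typer's node (leaf `…/ManinAdditive/CuspidalKummerUFamilyCurve.lean`, p697376) BY NAME, so an's
`uFamily_two_not_dvd_c_of_odd` (B6, TURNKEY-an-26) loses its `UFamilyConductorLaw` hypothesis.

HONEST FRAMING: an elementary conductor computation on an explicit family; it removes ONE of the two census-shaped inputs of an's
odd-`u` theorem (the other, E-an-150 `UFamilyOddDegreeAtFour` — odd modular degree — is a genuine law and stays).  BSD is not proved
by this; Manin's conjecture is not proved; C2 OPEN.
[cite: BarriosEtAl2025, Thm. 5.1 (arXiv:2501.03209 pp. 15–16), rows IV* → I₀* and IV → II, (f, f^d) = (2, 4)]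
[cite: SilvermanAEC2009, X.5 Cor. 5.4 and C.16]
-/

set_option autoImplicit false
-- lint-debt: the directory name repeats the summit name (sibling precedent `ManinLocalTwoThreeNegOneTwistConductorAtTwo.lean`)
set_option linter.dupNamespace false

noncomputable section

open scoped Classical
open WeierstrassCurve

namespace Summit.BirchSwinnertonDyer.BirchSwinnertonDyer.Theorems.ManinLocalTwoThree

/-- `N((W ⊗ (−1)) ⊗ (−1)) = N(W)`: the double twist is `W ⊗ 1 ≅ W` over `ℚ`. [cite: SilvermanAEC2009, X.5 Cor. 5.4] -/
theorem conductorNorm_quadraticTwist_negOne_negOne (W : WeierstrassCurve ℚ) [W.IsElliptic] :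
    ((W.quadraticTwist ((-1 : ℤ) : ℚ)).quadraticTwist ((-1 : ℤ) : ℚ)).conductorNorm ℤ = W.conductorNorm ℤ := by
  obtain ⟨C, hC⟩ := W.exists_variableChange_quadraticTwist_one
  rw [WeierstrassCurve.quadraticTwist_quadraticTwist, show ((-1 : ℤ) : ℚ) * ((-1 : ℤ) : ℚ) = 1 by norm_num, ← hC]
  rw [WeierstrassCurve.conductorNorm_smul]

/-- **S-an-64 `UFamilyConductorLaw` (an g32, MEMO-an §75.11; CANDIDATES row S-an-64) — the BODY, PROVED** (hypothesis = an's `IsUFamilyCurve W u` unfolded, conclusion = the body of the typer's node `UFamilyConductorLaw` VERBATIM; the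
by-name form is `uFamilyConductorLaw_holds` below).
For the totally-blind family `y² = (x + u)(x² + 4)`, `u` odd: `u ≡ 1 (mod 4)` ⟹ `4 ∥ N(W)` (Kodaira IV* at `2`, `ord₂ Δ = 8`,
`f₂ = 2`, §3); `u ≡ 3 (mod 4)` ⟹ `N(W) = 4 · N(W ⊗ χ₋₄)` (the twist is the member `−u ≡ 1 (mod 4)` of the family, so `4 ∥ N(W ⊗ χ₋₄)`,
and p2's S-an-58 `conductorNorm_quadraticTwist_negOne_eq_four_mul` applied to the twist gives `N(W ⊗ χ₋₄ ⊗ χ₋₄) = 4·N(W ⊗ χ₋₄)` with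
`W ⊗ χ₋₄ ⊗ χ₋₄ ≅ W`).  Census (an g32 blind_census.out 86a231102f868176): 55 IV* classes at `4(u²+4)′`, 31 I₀* classes at `16 ∣ N`.
HONEST FRAMING: a finite symbolic computation (Tate's algorithm) on an explicit family; it removes the census-law input `h64` of an's
`uFamily_two_not_dvd_c_of_odd` (odd-`u` half of E-an-50R), which stays conditional on E-an-150 (odd modular degree) and ČNS.
BSD is not proved by this; Manin's conjecture is not proved; C2 OPEN.
[cite: BarriosEtAl2025, Thm. 5.1 (arXiv:2501.03209 pp. 15–16), row IV* → I₀*, (f, f^d) = (2, 4)] [cite: SilvermanATAEC1994, IV.9.4 and IV.11.1] -/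
theorem uFamilyConductorLaw_of (W : WeierstrassCurve ℚ) [W.IsElliptic] (u : ℤ)
    (hW : ∃ (C : VariableChange ℚ) (s : ℤ), (C • W).a₁ = 0 ∧ (C • W).a₃ = 0 ∧ (C • W).a₂ = (3 * s + u : ℤ) ∧
      (C • W).a₄ = (3 * s ^ 2 + 2 * s * u + 4 : ℤ) ∧ (C • W).a₆ = ((s + u) * (s ^ 2 + 4) : ℤ)) :
    (u % 4 = 1 → 2 ^ 2 ∣ W.conductorNorm ℤ ∧ ¬ 2 ^ 3 ∣ W.conductorNorm ℤ) ∧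
    (u % 4 = 3 → (haveI := W.isElliptic_quadraticTwist (show ((-1 : ℤ) : ℚ) ≠ 0 by norm_num);
      4 * (W.quadraticTwist ((-1 : ℤ) : ℚ)).conductorNorm ℤ) = W.conductorNorm ℤ) := by
  haveI : Fact (Nat.Prime 2) := ⟨Nat.prime_two⟩
  -- `v₂(N) = 2 ⟹ 4 ∥ N` for any elliptic `V` in the family with parameter `≡ 1 (mod 4)`
  have part1 : ∀ (V : WeierstrassCurve ℚ) [V.IsElliptic] (w : ℤ), w % 4 = 1 →
      (∃ (C : VariableChange ℚ) (s : ℤ), (C • V).a₁ = 0 ∧ (C • V).a₃ = 0 ∧ (C • V).a₂ = (3 * s + w : ℤ) ∧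
        (C • V).a₄ = (3 * s ^ 2 + 2 * s * w + 4 : ℤ) ∧ (C • V).a₆ = ((s + w) * (s ^ 2 + 4) : ℤ)) →
      2 ^ 2 ∣ V.conductorNorm ℤ ∧ ¬ 2 ^ 3 ∣ V.conductorNorm ℤ := by
    intro V _ w hw hV
    have hN0 : V.conductorNorm ℤ ≠ 0 := (V.conductorNorm_pos_holds).ne'
    have h2 := padicValNat_two_conductorNorm_of_uFamily V w hw hV
    rw [padicValNat_dvd_iff_le hN0, padicValNat_dvd_iff_le hN0, h2]
    omega
  refine ⟨fun hu ↦ part1 W u hu hW, fun hu ↦ ?_⟩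
  have hd0 : ((-1 : ℤ) : ℚ) ≠ 0 := by norm_num
  haveI := W.isElliptic_quadraticTwist hd0
  have hu' : (-u) % 4 = 1 := by omega
  obtain ⟨h4, h8⟩ := part1 (W.quadraticTwist ((-1 : ℤ) : ℚ)) (-u) hu' (uFamily_quadraticTwist_negOne hW)
  have h := conductorNorm_quadraticTwist_negOne_eq_four_mul (W.quadraticTwist ((-1 : ℤ) : ℚ)) h4 h8
  rw [conductorNorm_quadraticTwist_negOne_negOne] at h
  exact h.symm

/-- **S-an-64 `UFamilyConductorLaw` HOLDS (BY NAME)** — the typer's node (leaf `…/ManinAdditive/CuspidalKummerUFamilyCurve.lean`,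
an g32 MEMO-an §75.11) discharged: on the totally-blind family `y² = (x + u)(x² + 4)`, `u ≡ 1 (mod 4) ⟹ 4 ∥ N(W)` and
`u ≡ 3 (mod 4) ⟹ N(W) = 4·N(W ⊗ χ₋₄)`.  BSD is not proved by this; Manin's conjecture is not proved; C2 OPEN.
[cite: BarriosEtAl2025, Thm. 5.1 (arXiv:2501.03209 pp. 15–16), row IV* → I₀*] [cite: SilvermanATAEC1994, IV.9.4 and IV.11.1] -/
theorem uFamilyConductorLaw_holds : Summit.BirchSwinnertonDyer.Rank1Residual.ManinAdditive.UFamilyConductorLaw :=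
  fun W _ u hW ↦ uFamilyConductorLaw_of W u hW

end Summit.BirchSwinnertonDyer.BirchSwinnertonDyer.Theorems.ManinLocalTwoThree

end
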